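import Literature.Analysis.FunctionSpaces.WeakLpQuantitative
import Summits.NavierStokesRegularity.NavierStokesRegularity.Theorems.SoloSalvageWu2026WeakLpAlgebra
import Summits.NavierStokesRegularity.NavierStokesRegularity.Theorems.SoloSalvageWu2026PressureBilinear
import HarnessLib

/-!
# C177 `Wu2026` — toward `Step_341` (§3.3, (3.41)): the canonical pressure of a weak-`L^{9/2}`
# field is weak-`L^{9/4}`: `v ∈ L^{9/2,∞} ⇒ p̃[v] ∈ L^{9/4,∞}` (real interpolation by height splitting)

Seat `ns-in-wu-341` (D-0154 (2) INPUTS, director-ns req136; A3 Wu 2026, KEY `Step_341`), filed in the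
salvage namespace `…Theorems.Wu2026Salvage` (theorems only, standard axioms, no definition, no named fact).

The printed step (arXiv:2608.22471v1, p.14 l.44 – p.15 l.7, (3.41)): «Since v ∈ L^{9/2,∞}, we have
v ⊗ v ∈ L^{9/4,∞}, and the boundedness of Riesz transforms on Lorentz spaces gives
‖p‖_{L^{9/4,∞}} + ‖p + |v|²/2‖_{L^{9/4,∞}} ≤ C.» The tree has the Calderón–Zygmund theory of the
canonical pressure `p̃[w] = normalisedPressure w` on the LEBESGUE classes `|w|² ∈ L^q`, `1 < q < ∞`
(Stein's bound `memLp_normalisedPressure_of_memLp_two_mul` / `exists_eLpNorm_normalisedPressure_le_sq`,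
and the bilinear difference identity `exists_normalisedPressure_sub_ae_eq`), but no Lorentz-space
boundedness. This file proves the weak-type bound at the one exponent needed, by the classical real
interpolation argument (Marcinkiewicz / Grafakos Thm 1.3.2, height splitting), adapted to the
QUADRATIC map `w ↦ p̃[w]` through its bilinear structure:

for a level `t = 3λ > 0` split `v = h + b` at height `s = λ^{1/2}` (`b = v𝟙_{|v|≤s}`,
`h = v𝟙_{|v|>s}`); then a.e. `p̃[v] = p̃[b] − ⟨v−b, v+b⟩/3 + P` with `‖P‖₂ ≤ K‖|v−b||v+b|‖₂ = K‖|h|²‖₂`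
(`|v−b||v+b| = |h|²` pointwise), so
`{t < |p̃[v]|} ⊆ {λ < |p̃[b]|} ∪ {s < |v|} ∪ {λ < |P|}` a.e., and by Chebyshev, Stein's bound at
exponent `3` and the two layer-cake tails of a weak-`L^{9/2}` function
(`MemWeakLp.lintegral_rpow_indicator_norm_le_le`: `∫|b|⁶ ≤ 4 s^{3/2} W`;
`MemWeakLp.lintegral_rpow_indicator_lt_norm_le`: `∫|h|⁴ ≤ 9 s^{-1/2} W`; `W = ‖v‖^{9/2}_{9/2,∞}`):
`|{λ<|p̃[b]|}| ≤ C³·4 s^{3/2}W/λ³`, `|{s<|v|}| ≤ W s^{-9/2}`, `|{λ<|P|}| ≤ K²·9 s^{-1/2}W/λ²`, each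
`= O(λ^{-9/4})` — i.e. `t^{9/4}|{t < |p̃[v]|}| ≤ M < ∞`.

(The difference identity with the product at an exponent different from those of `|a|²`, `|b|²`
is `exists_normalisedPressure_sub_ae_eq₃` of `SoloSalvageWu2026PressureBilinear`.)
* `memWeakLp_normalisedPressure_nine_fourths` — for `v` continuous, `v ∈ L^{9/2,∞}(ℝ³)` and `v ∈ L⁶`
  (the latter only to place `v` in a Lebesgue class of the tree's theory; for Wu's flows `v` is
  bounded): `p̃[v] ∈ L^{9/4,∞}(ℝ³)` — Wu's (3.41), first summand.

WHAT THIS IS NOT: not a claim about NS regularity or blow-up; not a claim about any author beyond the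
typed locator; a printed step is being re-proved as typed.
-/

noncomputable section

set_option linter.dupNamespace false

open MeasureTheory Set Function Filter Topology Metric
open scoped ENNReal NNReal RealInnerProductSpace

namespace Summit.NavierStokesRegularity.NavierStokesRegularity.Theorems.Wu2026Salvage

open Literature.Claims.NS.Wu2026 Literature.Analysis.FluidPDE Literature.Analysis.FunctionSpaces

-- nested operator types in the imported pressure files
set_option maxSynthPendingDepth 3

/-! ### The weak-type bound -/

/-- **`v ∈ L^{9/2,∞}(ℝ³) ⇒ p̃[v] ∈ L^{9/4,∞}(ℝ³)`** for a continuous `v` which also lies in `L⁶`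
(Wu 2026, (3.41), first summand: «Since v ∈ L^{9/2,∞}, we have v ⊗ v ∈ L^{9/4,∞}, and the
boundedness of Riesz transforms on Lorentz spaces gives ‖p‖_{L^{9/4,∞}} ≤ C»). Proof: real
interpolation by height splitting of `v` at `s = (t/3)^{1/2}` between Stein's `L³ → L³`-type bound
for the low part and the bilinear `L²` bound for the difference, see the module docstring.
[cite: Wu2026, (3.41) p.14 l.44 – p.15 l.7; Stein1971, Ch. II §4.2 Thm 3] -/
theorem memWeakLp_normalisedPressure_nine_fourths {v : E3 → E3} (hv : Continuous v)
    (hvw : MemWeakLp v ((9 : ℝ≥0∞) / 2) volume) (hv6 : MemLp v (2 * 3) volume) :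
    MemWeakLp (normalisedPressure v) ((9 : ℝ≥0∞) / 4) volume := by
  -- exponents
  have h92 : ((9 : ℝ≥0∞) / 2).toReal = 9 / 2 := by rw [ENNReal.toReal_div]; norm_num
  have h94 : ((9 : ℝ≥0∞) / 4).toReal = 9 / 4 := by rw [ENNReal.toReal_div]; norm_num
  have h3_1 : (1 : ℝ≥0∞) < 3 := by norm_num
  have h3_t : (3 : ℝ≥0∞) < ⊤ := ENNReal.ofNat_lt_top
  have h2_1 : (1 : ℝ≥0∞) < 2 := by norm_num
  have h2_t : (2 : ℝ≥0∞) < ⊤ := ENNReal.ofNat_lt_top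
  have h23_0 : (2 * 3 : ℝ≥0∞) ≠ 0 := by norm_num
  have h23_t : (2 * 3 : ℝ≥0∞) ≠ ⊤ := by norm_num
  have h23_r : (2 * 3 : ℝ≥0∞).toReal = 6 := by norm_num
  have h22_0 : (2 * 2 : ℝ≥0∞) ≠ 0 := by norm_num
  have h22_t : (2 * 2 : ℝ≥0∞) ≠ ⊤ := by norm_num
  have h22_r : (2 * 2 : ℝ≥0∞).toReal = 4 := by norm_num
  -- the weak quasinorm of `v`
  set W : ℝ≥0∞ := eWeakLpPow v ((9 : ℝ≥0∞) / 2) volume with hW_def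
  have hWt : W < ⊤ := hvw.2
  have hvm : AEStronglyMeasurable v volume := hv.aestronglyMeasurable
  -- the two constants: bilinear `L²` and Stein `L³`
  obtain ⟨K, hKt, hK⟩ := exists_normalisedPressure_sub_ae_eq₃ (pa := 3) (pb := 3) (p := 2)
    h3_1 h3_t h3_1 h3_t h2_1 h2_t
  obtain ⟨C, hC⟩ := exists_eLpNorm_normalisedPressure_le_sq (p := (3 : ℝ≥0∞)) h3_1 h3_t
  -- measurability of `p̃[v]`
  have hv_sq : MemLp (fun y => ‖v y‖ ^ 2) 3 volume := memLp_norm_sq_of_memLp_two_mul hv6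
  have hPm : AEStronglyMeasurable (normalisedPressure v) volume :=
    aestronglyMeasurable_normalisedPressure_of_sq h3_1 h3_t hvm hv_sq
  -- the bound
  set M₁ : ℝ≥0∞ := ENNReal.ofReal ((3 : ℝ) ^ (9 / 4 : ℝ) * 4) * ((C : ℝ≥0∞) ^ (3 : ℝ) * W)
    with hM₁
  set M₂ : ℝ≥0∞ := ENNReal.ofReal ((3 : ℝ) ^ (9 / 4 : ℝ)) * W with hM₂
  set M₃ : ℝ≥0∞ := ENNReal.ofReal ((3 : ℝ) ^ (9 / 4 : ℝ) * 9) * (K ^ (2 : ℝ) * W) with hM₃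
  have hMt : M₁ + M₂ + M₃ < ⊤ := by
    have hC3 : (C : ℝ≥0∞) ^ (3 : ℝ) < ⊤ := ENNReal.rpow_lt_top_of_nonneg (by norm_num) ENNReal.coe_ne_top
    have hK2 : K ^ (2 : ℝ) < ⊤ := ENNReal.rpow_lt_top_of_nonneg (by norm_num) hKt
    have h1 : M₁ < ⊤ := ENNReal.mul_lt_top ENNReal.ofReal_lt_top (ENNReal.mul_lt_top hC3 hWt)
    have h2 : M₂ < ⊤ := ENNReal.mul_lt_top ENNReal.ofReal_lt_top hWt
    have h3 : M₃ < ⊤ := ENNReal.mul_lt_top ENNReal.ofReal_lt_top (ENNReal.mul_lt_top hK2 hWt)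
    exact ENNReal.add_lt_top.2 ⟨ENNReal.add_lt_top.2 ⟨h1, h2⟩, h3⟩
  refine memWeakLp_of_forall hPm (by rw [h94]; norm_num) hMt fun t ht => ?_
  rw [h94]
  -- the level `λ = t/3` and the height `s = λ^{1/2}`
  set lam : ℝ := t / 3 with hlam_def
  have hlam : 0 < lam := by positivity
  have ht3 : t = 3 * lam := by rw [hlam_def]; ring
  set s : ℝ := lam ^ (1 / 2 : ℝ) with hs_def
  have hs : 0 < s := Real.rpow_pos_of_pos hlam _
  -- the truncations
  set B : Set E3 := {x | ‖v x‖ ≤ s} with hB_def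
  set A : Set E3 := {x | s < ‖v x‖} with hA_def
  have hBm : MeasurableSet B := (isClosed_le hv.norm continuous_const).measurableSet
  have hAm : MeasurableSet A := (isOpen_lt continuous_const hv.norm).measurableSet
  set b : E3 → E3 := B.indicator v with hb_def
  set h : E3 → E3 := A.indicator v with hh_def
  have hbm : AEStronglyMeasurable b volume := hvm.indicator hBm
  have hhm : AEStronglyMeasurable h volume := hvm.indicator hAm
  -- pointwise: off `A` the two fields agree; `|v - b||v + b| = |h|²`
  have hvb : ∀ x, x ∉ A → b x = v x := fun x hx => by
    have hxB : x ∈ B := by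
      simp only [hA_def, mem_setOf_eq, not_lt] at hx
      exact hx
    rw [hb_def, indicator_of_mem hxB]
  have hprod_eq : (fun y => ‖v y - b y‖ * ‖v y + b y‖) = fun y => ‖h y‖ ^ 2 := by
    funext y
    by_cases hy : y ∈ A
    · have hyB : y ∉ B := by
        simp only [hB_def, mem_setOf_eq, not_le]
        exact hy
      rw [hb_def, indicator_of_notMem hyB, hh_def, indicator_of_mem hy, sub_zero, add_zero, sq]
    · rw [hvb y hy, hh_def, indicator_of_notMem hy, sub_self, norm_zero, zero_mul, sq, mul_zero]
  -- layer cake: the low part in `L⁶`, the high part in `L⁴`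
  have hb6 : ∫⁻ x, ‖b x‖ₑ ^ (6 : ℝ) ≤ ENNReal.ofReal (4 * s ^ (3 / 2 : ℝ)) * W := by
    have h0 := MemWeakLp.lintegral_rpow_indicator_norm_le_le (f := v) (p := (9 : ℝ≥0∞) / 2)
      (μ := volume) hvm hBm (q := 6) (by rw [h92]; norm_num) hs
    rw [h92] at h0
    refine h0.trans_eq ?_
    congr 2
    norm_num
  have hh4 : ∫⁻ x, ‖h x‖ₑ ^ (4 : ℝ) ≤ ENNReal.ofReal (9 * s ^ (-(1 / 2) : ℝ)) * W := by
    have h0 := MemWeakLp.lintegral_rpow_indicator_lt_norm_le (f := v) (p := (9 : ℝ≥0∞) / 2)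
      (μ := volume) hvm hAm (r := 4) (by norm_num) (by rw [h92]; norm_num) hs
    rw [h92] at h0
    refine h0.trans_eq ?_
    congr 2
    norm_num
  have hb6t : ∫⁻ x, ‖b x‖ₑ ^ (6 : ℝ) ≠ ⊤ :=
    (hb6.trans_lt (ENNReal.mul_lt_top ENNReal.ofReal_lt_top hWt)).ne
  have hh4t : ∫⁻ x, ‖h x‖ₑ ^ (4 : ℝ) ≠ ⊤ :=
    (hh4.trans_lt (ENNReal.mul_lt_top ENNReal.ofReal_lt_top hWt)).ne
  -- memberships
  have hb_mem : MemLp b (2 * 3) volume := by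
    refine ⟨hbm, ?_⟩
    rw [eLpNorm_lt_top_iff_lintegral_rpow_enorm_lt_top h23_0 h23_t, h23_r]
    exact lt_top_iff_ne_top.2 hb6t
  have hh_mem : MemLp h (2 * 2) volume := by
    refine ⟨hhm, ?_⟩
    rw [eLpNorm_lt_top_iff_lintegral_rpow_enorm_lt_top h22_0 h22_t, h22_r]
    exact lt_top_iff_ne_top.2 hh4t
  have hb_sq : MemLp (fun y => ‖b y‖ ^ 2) 3 volume := memLp_norm_sq_of_memLp_two_mul hb_mem
  have hh_sq : MemLp (fun y => ‖h y‖ ^ 2) 2 volume := memLp_norm_sq_of_memLp_two_mul hh_mem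
  have hprod : MemLp (fun y => ‖v y - b y‖ * ‖v y + b y‖) 2 volume := by
    rw [hprod_eq]; exact hh_sq
  -- the difference identity
  obtain ⟨P, hPm', hident, hPle⟩ := hK v b hvm hbm hv_sq hb_sq hprod
  rw [hprod_eq] at hPle
  -- the three superlevel sets
  set S₁ : Set E3 := {x | lam < ‖normalisedPressure b x‖} with hS₁
  set S₃ : Set E3 := {x | lam < ‖P x‖} with hS₃
  have hincl : ∀ᵐ x ∂(volume : Measure E3),
      x ∈ {x | t < ‖normalisedPressure v x‖} → x ∈ S₁ ∪ A ∪ S₃ := by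
    filter_upwards [hident] with x hx hxt
    change t < ‖normalisedPressure v x‖ at hxt
    by_cases hxA : x ∈ A
    · exact Or.inl (Or.inr hxA)
    · have hx' : normalisedPressure v x = normalisedPressure b x + P x := by
        have := hx
        simp only [hvb x hxA, sub_self, inner_zero_left, mul_zero, zero_add] at this
        linarith
      rw [hx'] at hxt
      by_contra hcon
      simp only [mem_union, hS₁, hS₃, mem_setOf_eq, not_or, not_lt] at hcon
      have h1 := hcon.1.1
      have h3 := hcon.2
      have := norm_add_le (normalisedPressure b x) (P x)
      linarith
  have hμ : volume {x | t < ‖normalisedPressure v x‖} ≤ volume S₁ + volume A + volume S₃ :=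
    calc volume {x | t < ‖normalisedPressure v x‖} ≤ volume (S₁ ∪ A ∪ S₃) := measure_mono_ae hincl
      _ ≤ volume (S₁ ∪ A) + volume S₃ := measure_union_le _ _
      _ ≤ volume S₁ + volume A + volume S₃ := add_le_add (measure_union_le _ _) le_rfl
  -- (E1) the low part: Chebyshev in `L³` and Stein
  have hE1 : ENNReal.ofReal lam ^ (3 : ℝ) * volume S₁ ≤
      (C : ℝ≥0∞) ^ (3 : ℝ) * (ENNReal.ofReal (4 * s ^ (3 / 2 : ℝ)) * W) := by
    have hpbm : AEStronglyMeasurable (normalisedPressure b) volume :=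
      aestronglyMeasurable_normalisedPressure_of_sq h3_1 h3_t hbm hb_sq
    have hcheb := mul_meas_ge_le_pow_eLpNorm' volume (p := (3 : ℝ≥0∞)) (by norm_num)
      ENNReal.ofNat_ne_top hpbm (ENNReal.ofReal lam)
    rw [ENNReal.toReal_ofNat] at hcheb
    have hX : eLpNorm b (2 * 3) volume ^ (6 : ℝ) = ∫⁻ x, ‖b x‖ₑ ^ (6 : ℝ) := by
      rw [← h23_r]; exact eLpNorm_rpow_toReal_eq_lintegral b h23_0 h23_t
    calc ENNReal.ofReal lam ^ (3 : ℝ) * volume S₁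
        ≤ ENNReal.ofReal lam ^ (3 : ℝ) *
            volume {x | ENNReal.ofReal lam ≤ ‖normalisedPressure b x‖ₑ} :=
          mul_le_mul' le_rfl (measure_mono (setOf_lt_norm_subset_setOf_ofReal_le_enorm _ _))
      _ ≤ eLpNorm (normalisedPressure b) 3 volume ^ (3 : ℝ) := hcheb
      _ ≤ ((C : ℝ≥0∞) * eLpNorm b (2 * 3) volume ^ 2) ^ (3 : ℝ) :=
          ENNReal.rpow_le_rpow (hC b hb_mem) (by norm_num)
      _ = (C : ℝ≥0∞) ^ (3 : ℝ) * ∫⁻ x, ‖b x‖ₑ ^ (6 : ℝ) := by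
          rw [ENNReal.mul_rpow_of_nonneg _ _ (by norm_num), ← ENNReal.rpow_natCast,
            ← ENNReal.rpow_mul, ← hX]
          norm_num
      _ ≤ (C : ℝ≥0∞) ^ (3 : ℝ) * (ENNReal.ofReal (4 * s ^ (3 / 2 : ℝ)) * W) :=
          mul_le_mul' le_rfl hb6
  -- (E2) the middle part: the distribution function of `v` at height `s`
  have hE2 : volume A ≤ W * ENNReal.ofReal (s ^ (-(9 / 2) : ℝ)) := by
    have h0 := meas_lt_norm_le_eWeakLpPow_mul_ofReal_rpow_neg v ((9 : ℝ≥0∞) / 2) volume hs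
    rwa [h92] at h0
  -- (E3) the high part: Chebyshev in `L²` and the bilinear bound
  have hE3 : ENNReal.ofReal lam ^ (2 : ℝ) * volume S₃ ≤
      K ^ (2 : ℝ) * (ENNReal.ofReal (9 * s ^ (-(1 / 2) : ℝ)) * W) := by
    have hcheb := mul_meas_ge_le_pow_eLpNorm' volume (p := (2 : ℝ≥0∞)) (by norm_num)
      ENNReal.ofNat_ne_top hPm' (ENNReal.ofReal lam)
    rw [ENNReal.toReal_ofNat] at hcheb
    have hY : eLpNorm (fun y => ‖h y‖ ^ 2) 2 volume ^ (2 : ℝ) = ∫⁻ x, ‖h x‖ₑ ^ (4 : ℝ) := by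
      have e := eLpNorm_rpow_toReal_eq_lintegral (μ := volume) (fun y => ‖h y‖ ^ 2)
        (p := (2 : ℝ≥0∞)) (by norm_num) ENNReal.ofNat_ne_top
      rw [ENNReal.toReal_ofNat] at e
      rw [e]
      refine lintegral_congr fun x => ?_
      rw [enorm_norm_sq_rpow]
      norm_num
    calc ENNReal.ofReal lam ^ (2 : ℝ) * volume S₃
        ≤ ENNReal.ofReal lam ^ (2 : ℝ) * volume {x | ENNReal.ofReal lam ≤ ‖P x‖ₑ} :=
          mul_le_mul' le_rfl (measure_mono (setOf_lt_norm_subset_setOf_ofReal_le_enorm _ _))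
      _ ≤ eLpNorm P 2 volume ^ (2 : ℝ) := hcheb
      _ ≤ (K * eLpNorm (fun y => ‖h y‖ ^ 2) 2 volume) ^ (2 : ℝ) :=
          ENNReal.rpow_le_rpow hPle (by norm_num)
      _ = K ^ (2 : ℝ) * ∫⁻ x, ‖h x‖ₑ ^ (4 : ℝ) := by
          rw [ENNReal.mul_rpow_of_nonneg _ _ (by norm_num), hY]
      _ ≤ K ^ (2 : ℝ) * (ENNReal.ofReal (9 * s ^ (-(1 / 2) : ℝ)) * W) :=
          mul_le_mul' le_rfl hh4
  -- real-exponent bookkeeping (`s = λ^{1/2}`, `t = 3λ`)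
  have hs32 : s ^ (3 / 2 : ℝ) = lam ^ (3 / 4 : ℝ) := by
    rw [hs_def, ← Real.rpow_mul hlam.le]; norm_num
  have hs12 : s ^ (-(1 / 2) : ℝ) = lam ^ (-(1 / 4) : ℝ) := by
    rw [hs_def, ← Real.rpow_mul hlam.le]; norm_num
  have hs92 : s ^ (-(9 / 2) : ℝ) = lam ^ (-(9 / 4) : ℝ) := by
    rw [hs_def, ← Real.rpow_mul hlam.le]; norm_num
  have ht1 : t ^ (9 / 4 : ℝ) = (3 : ℝ) ^ (9 / 4 : ℝ) * lam ^ (-(3 / 4) : ℝ) * lam ^ (3 : ℝ) := by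
    rw [ht3, Real.mul_rpow (by norm_num) hlam.le, mul_assoc, ← Real.rpow_add hlam]; norm_num
  have ht2 : t ^ (9 / 4 : ℝ) * lam ^ (-(9 / 4) : ℝ) = (3 : ℝ) ^ (9 / 4 : ℝ) := by
    rw [ht3, Real.mul_rpow (by norm_num) hlam.le, mul_assoc, ← Real.rpow_add hlam]; norm_num
  have ht3' : t ^ (9 / 4 : ℝ) = (3 : ℝ) ^ (9 / 4 : ℝ) * lam ^ (1 / 4 : ℝ) * lam ^ (2 : ℝ) := by
    rw [ht3, Real.mul_rpow (by norm_num) hlam.le, mul_assoc, ← Real.rpow_add hlam]; norm_num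
  have hr1 : (3 : ℝ) ^ (9 / 4 : ℝ) * lam ^ (-(3 / 4) : ℝ) * (4 * s ^ (3 / 2 : ℝ)) =
      (3 : ℝ) ^ (9 / 4 : ℝ) * 4 := by
    rw [hs32, show (3 : ℝ) ^ (9 / 4 : ℝ) * lam ^ (-(3 / 4) : ℝ) * (4 * lam ^ (3 / 4 : ℝ)) =
      (3 : ℝ) ^ (9 / 4 : ℝ) * 4 * (lam ^ (-(3 / 4) : ℝ) * lam ^ (3 / 4 : ℝ)) by ring,
      ← Real.rpow_add hlam]
    norm_num
  have hr3 : (3 : ℝ) ^ (9 / 4 : ℝ) * lam ^ (1 / 4 : ℝ) * (9 * s ^ (-(1 / 2) : ℝ)) =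
      (3 : ℝ) ^ (9 / 4 : ℝ) * 9 := by
    rw [hs12, show (3 : ℝ) ^ (9 / 4 : ℝ) * lam ^ (1 / 4 : ℝ) * (9 * lam ^ (-(1 / 4) : ℝ)) =
      (3 : ℝ) ^ (9 / 4 : ℝ) * 9 * (lam ^ (1 / 4 : ℝ) * lam ^ (-(1 / 4) : ℝ)) by ring,
      ← Real.rpow_add hlam]
    norm_num
  have h34 : 0 ≤ (3 : ℝ) ^ (9 / 4 : ℝ) * lam ^ (-(3 / 4) : ℝ) := by positivity
  have h14 : 0 ≤ (3 : ℝ) ^ (9 / 4 : ℝ) * lam ^ (1 / 4 : ℝ) := by positivity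
  -- (T1)
  have hT1 : ENNReal.ofReal (t ^ (9 / 4 : ℝ)) * volume S₁ ≤ M₁ := by
    have e : ENNReal.ofReal (t ^ (9 / 4 : ℝ)) =
        ENNReal.ofReal ((3 : ℝ) ^ (9 / 4 : ℝ) * lam ^ (-(3 / 4) : ℝ)) *
          ENNReal.ofReal lam ^ (3 : ℝ) := by
      rw [ht1, ENNReal.ofReal_mul h34, ENNReal.ofReal_rpow_of_pos hlam]
    calc ENNReal.ofReal (t ^ (9 / 4 : ℝ)) * volume S₁
        = ENNReal.ofReal ((3 : ℝ) ^ (9 / 4 : ℝ) * lam ^ (-(3 / 4) : ℝ)) *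
            (ENNReal.ofReal lam ^ (3 : ℝ) * volume S₁) := by rw [e, mul_assoc]
      _ ≤ ENNReal.ofReal ((3 : ℝ) ^ (9 / 4 : ℝ) * lam ^ (-(3 / 4) : ℝ)) *
            ((C : ℝ≥0∞) ^ (3 : ℝ) * (ENNReal.ofReal (4 * s ^ (3 / 2 : ℝ)) * W)) :=
          mul_le_mul' le_rfl hE1
      _ = ENNReal.ofReal ((3 : ℝ) ^ (9 / 4 : ℝ) * lam ^ (-(3 / 4) : ℝ)) *
            ENNReal.ofReal (4 * s ^ (3 / 2 : ℝ)) * ((C : ℝ≥0∞) ^ (3 : ℝ) * W) := by ring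
      _ = M₁ := by
          rw [hM₁, ← ENNReal.ofReal_mul h34, hr1]
  -- (T2)
  have hT2 : ENNReal.ofReal (t ^ (9 / 4 : ℝ)) * volume A ≤ M₂ := by
    calc ENNReal.ofReal (t ^ (9 / 4 : ℝ)) * volume A
        ≤ ENNReal.ofReal (t ^ (9 / 4 : ℝ)) * (W * ENNReal.ofReal (s ^ (-(9 / 2) : ℝ))) :=
          mul_le_mul' le_rfl hE2
      _ = ENNReal.ofReal (t ^ (9 / 4 : ℝ)) * ENNReal.ofReal (s ^ (-(9 / 2) : ℝ)) * W := by ring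
      _ = M₂ := by
          rw [hM₂, ← ENNReal.ofReal_mul (Real.rpow_nonneg ht.le _), hs92, ht2]
  -- (T3)
  have hT3 : ENNReal.ofReal (t ^ (9 / 4 : ℝ)) * volume S₃ ≤ M₃ := by
    have e : ENNReal.ofReal (t ^ (9 / 4 : ℝ)) =
        ENNReal.ofReal ((3 : ℝ) ^ (9 / 4 : ℝ) * lam ^ (1 / 4 : ℝ)) *
          ENNReal.ofReal lam ^ (2 : ℝ) := by
      rw [ht3', ENNReal.ofReal_mul h14, ENNReal.ofReal_rpow_of_pos hlam]
    calc ENNReal.ofReal (t ^ (9 / 4 : ℝ)) * volume S₃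
        = ENNReal.ofReal ((3 : ℝ) ^ (9 / 4 : ℝ) * lam ^ (1 / 4 : ℝ)) *
            (ENNReal.ofReal lam ^ (2 : ℝ) * volume S₃) := by rw [e, mul_assoc]
      _ ≤ ENNReal.ofReal ((3 : ℝ) ^ (9 / 4 : ℝ) * lam ^ (1 / 4 : ℝ)) *
            (K ^ (2 : ℝ) * (ENNReal.ofReal (9 * s ^ (-(1 / 2) : ℝ)) * W)) :=
          mul_le_mul' le_rfl hE3
      _ = ENNReal.ofReal ((3 : ℝ) ^ (9 / 4 : ℝ) * lam ^ (1 / 4 : ℝ)) *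
            ENNReal.ofReal (9 * s ^ (-(1 / 2) : ℝ)) * (K ^ (2 : ℝ) * W) := by ring
      _ = M₃ := by
          rw [hM₃, ← ENNReal.ofReal_mul h14, hr3]
  -- assemble
  calc ENNReal.ofReal (t ^ (9 / 4 : ℝ)) * volume {x | t < ‖normalisedPressure v x‖}
      ≤ ENNReal.ofReal (t ^ (9 / 4 : ℝ)) * (volume S₁ + volume A + volume S₃) :=
        mul_le_mul' le_rfl hμ
    _ = ENNReal.ofReal (t ^ (9 / 4 : ℝ)) * volume S₁ + ENNReal.ofReal (t ^ (9 / 4 : ℝ)) * volume A +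
          ENNReal.ofReal (t ^ (9 / 4 : ℝ)) * volume S₃ := by ring
    _ ≤ M₁ + M₂ + M₃ := add_le_add_three hT1 hT2 hT3

end Summit.NavierStokesRegularity.NavierStokesRegularity.Theorems.Wu2026Salvage

end

-- WHAT THIS IS NOT: not a claim about NS regularity or blow-up; not a claim about any author beyond the typed locator.
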